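import Literature.NumberTheory.LFunctions.FrobeniusEigenvalueMultiset
import HarnessLib

/-!
# The characteristic polynomial of an endomorphism from the numbers `det(1 - fʳ)`
# (the `ℓ`-adic half of Weil's determination of the characteristic polynomial of Frobenius)

Topic `NumberTheory/LFunctions`; **proof file** (theorems, plus two auxiliary definitions
`FrobeniusCharpoly.eigenvalues`, `FrobeniusCharpoly.matrixOver`; D-0014, D-0026: no named facts).
Sibling of `FrobeniusEigenvalueMultiset` (the counting lemma), which it combines with linear algebra.

**Setting and result.** Let `K₀` be a field (in the application `ℚ_ℓ`), `V` a finite-dimensional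
`K₀`-vector space, `f` an automorphism of `V` (`det f ≠ 0`), `K̄ ⊇ K₀` algebraically closed and
`ι : K̄ → ℂ` a ring homomorphism (for `K̄ = ℚ̄_ℓ` such `ι` exist abstractly, Steinitz; the tree's
`PadicAlgCl.nonempty_ringEquiv_complex`). Suppose there are integers `N_r` and complex numbers
`β₁, …, β_m`, all of the same modulus `c > 1`, with
`det(1 - fʳ | V) = N_r` in `K₀` and `N_r = ∏ⱼ (1 - βⱼʳ)` in `ℂ`, for every `r ≥ 1`.
Then (`map_eigenvalues_eq`, `finrank_eq_card`, `charpoly_map_eq`, `map_trace_eq`):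
`dim V = m`, `ι` carries the eigenvalues of `f` (in `K̄`, with multiplicity) onto `{βⱼ}`, the
characteristic polynomial of `f` pushed to `ℂ` is `∏ⱼ (X - βⱼ)` and `ι(Tr f) = ∑ⱼ βⱼ`; consequently
(`trace_eq_intCast`, `charpoly_eq_map_of_prod_eq`) if `∑ βⱼ = t ∈ ℤ` then `Tr f = t` in `K₀`, and if
`∏ (X - βⱼ) = P ∈ ℤ[X]` then `charpoly f = P` in `K₀[X]`.

**Where it is used.** With `f` the Frobenius on `V_ℓ J` for the Jacobian `J = Pic⁰` of a curve over
`𝔽_q`, `N_r = #J(𝔽_{q^r})` ("`deg(1 - π^r) = det(1 - π^r | T_ℓ)`", Milne, *Abelian varieties*,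
Thm. 19.1 and its proof; Lang, *Abelian Varieties*, VII §1 Thm. 3), and `βⱼ = αⱼ` the reciprocal
roots of the `L`-polynomial (`#J(𝔽_{q^r}) = h(F𝔽_{q^r}) = ∏ (1 - αⱼʳ)`, `|αⱼ| = √q`), this is the
statement that the characteristic polynomial of Frobenius on `T_ℓ J` is the reciprocal `L`-polynomial
and `Tr(π | T_ℓ J) = ∑ αⱼ = q + 1 - #C(𝔽_q)` (Milne, *Jacobian varieties*, Thm. 11.1). Lang (VII §1,
Lemma, text p. 137) argues `ℓ`-adically with all polynomials `F(π)`; here only `F = 1 - Xʳ` is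
available on the geometric side, and the archimedean counting lemma
`FrobeniusMultiset.univ_val_map_eq` (sibling file) replaces Lang's lemma.

**Proof.** Over `K̄` the characteristic polynomial splits, `charpoly = ∏ (X - aᵢ)`; for any polynomial
`g`, `det g(A) = ∏ᵢ g(aᵢ)` (`det_aeval_eq_prod_roots`: factor `g = c ∏ (X - γₖ)` and use
`det(A - γ) = ∏ᵢ (aᵢ - γ)`, `Matrix.eval_charpoly`), in particular `det(1 - Aʳ) = ∏ᵢ (1 - aᵢʳ)`
(`det_one_sub_pow_eq_prod_roots`, `algebraMap_det_one_sub_pow`). Applying `ι`,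
`∏ᵢ (1 - ι(aᵢ)ʳ) = N_r = ∏ⱼ (1 - βⱼʳ)` for all `r`, the `aᵢ` being nonzero as `det f ≠ 0`; the counting
lemma gives `{ι(aᵢ)} = {βⱼ}`. The integrality statements follow from the injectivity of
`K₀ → K̄ → ℂ` (`Polynomial.map_injective`, `RingHom.ext_int`).

Also proved here (used downstream for the reciprocal roots of `L`-polynomials of constant field
extensions): **power sums determine a multiset of nonzero complex numbers**
(`univ_val_map_eq_of_forall_sum_pow_eq`, from the linear independence of geometric progressions,
`FrobeniusMultiset.eq_zero_of_forall_sum_mul_pow_eq_zero`).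

## References

* J. S. Milne, *Abelian Varieties*, in Cornell–Silverman, *Arithmetic Geometry* (1986), Ch. V,
  **Thm. 19.1 with its proof** ("`N_m = deg(π^m - 1) = ∏ (1 - aᵢ^m)`", PDF pp. 212–213 of the held
  copy `book:cornellnd-arithmetic-geometry`). [Milne1986AbelianVarieties]
* J. S. Milne, *Jacobian Varieties*, ibid. Ch. VII, Thm. 11.1 (PDF p. 272). [Milne1986JacobianVarieties]
* S. Lang, *Abelian Varieties* (Springer 1983), VII §1, Lemma (p. 137) and Thm. 3 (p. 138).
  [Lang1983AbelianVarieties]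

## Design notes

* `eigenvalues K f := (f.charpoly.map (algebraMap K₀ K)).roots`; `matrixOver K f` is the matrix of `f`
  in `Module.Free.chooseBasis` pushed to `K` (so that `LinearMap.charpoly_def` applies verbatim).
* Mathlib used: `Matrix.eval_charpoly`, `Matrix.charpoly_map`, `Matrix.charpoly_natDegree_eq_dim`,
  `Matrix.det_eq_prod_roots_charpoly`, `Matrix.trace_eq_sum_roots_charpoly`, `LinearMap.charpoly_def`,
  `LinearMap.det_toMatrix`, `LinearMap.toMatrixAlgEquiv`, `LinearMap.trace_eq_matrix_trace`,
  `Polynomial.Splits.eq_prod_roots(_of_monic)`, `Splits.eval_eq_prod_roots_of_monic`,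
  `Polynomial.map_injective`, `RingHom.ext_int`, `Finset.sum_comp`. Mathlib has no "spectral mapping
  for `det`" (`det (aeval A g)`; searched `det_aeval`, `aeval.*det`, `charpoly_pow`).
-/

noncomputable section

open Polynomial Matrix

namespace Literature.NumberTheory.LFunctions

namespace FrobeniusCharpoly

/-! ### `det g(A) = ∏ g(aᵢ)` over the eigenvalues (spectral mapping for the determinant) -/

section SpectralDet

variable {K : Type*} [Field K] [IsAlgClosed K] {n : Type*} [Fintype n] [DecidableEq n]

/-- Over an algebraically closed field the characteristic polynomial is `∏ (X - aᵢ)` over its roots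
(the eigenvalues with multiplicity). [folklore] -/
theorem charpoly_eq_prod_roots (A : Matrix n n K) :
    A.charpoly = (A.charpoly.roots.map fun a => X - C a).prod :=
  (IsAlgClosed.splits A.charpoly).eq_prod_roots_of_monic A.charpoly_monic

/-- The number of eigenvalues (with multiplicity) is the size of the matrix. [folklore] -/
theorem card_roots_charpoly (A : Matrix n n K) : Multiset.card A.charpoly.roots = Fintype.card n := by
  rw [← (IsAlgClosed.splits A.charpoly).natDegree_eq_card_roots, Matrix.charpoly_natDegree_eq_dim]

/-- `det (A - γ) = ∏ᵢ (aᵢ - γ)` over the eigenvalues `aᵢ`. [folklore] -/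
theorem det_sub_scalar_eq_prod_roots (A : Matrix n n K) (γ : K) :
    (A - Matrix.scalar n γ).det = (A.charpoly.roots.map fun a => a - γ).prod := by
  have h1 : A - Matrix.scalar n γ = (-1 : K) • (Matrix.scalar n γ - A) := by
    rw [neg_one_smul, neg_sub]
  rw [h1, Matrix.det_smul, ← Matrix.eval_charpoly,
    (IsAlgClosed.splits A.charpoly).eval_eq_prod_roots_of_monic A.charpoly_monic,
    ← card_roots_charpoly A, ← Multiset.prod_replicate, ← Multiset.map_const',
    ← Multiset.prod_map_mul]
  exact congrArg _ (Multiset.map_congr rfl fun a _ => by ring)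

/-- `det c = c^n = ∏ᵢ c` over the `n` eigenvalues. [folklore] -/
theorem det_scalar_eq_prod_roots (A : Matrix n n K) (c : K) :
    (Matrix.scalar n c).det = (A.charpoly.roots.map fun _ => c).prod := by
  rw [Matrix.scalar_apply, Matrix.det_diagonal, Finset.prod_const, Finset.card_univ,
    Multiset.map_const', Multiset.prod_replicate, card_roots_charpoly]

/-- **Spectral mapping for the determinant**: for every polynomial `g`,
`det g(A) = ∏ᵢ g(aᵢ)` over the eigenvalues `aᵢ` of `A` (with multiplicity). Proof: factor
`g = c ∏ₖ (X - γₖ)` and use `det (A - γₖ) = ∏ᵢ (aᵢ - γₖ)`, by induction on the number of factors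
(matrix products are not commutative, so no multiset product of matrices is formed). [folklore] -/
theorem det_aeval_eq_prod_roots (A : Matrix n n K) (g : K[X]) :
    (aeval A g).det = (A.charpoly.roots.map fun a => g.eval a).prod := by
  -- the statement for `c · ∏_{γ ∈ s} (X - γ)`, by induction on `s`
  have key : ∀ (s : Multiset K) (c : K),
      (aeval A (C c * (s.map fun γ => X - C γ).prod)).det =
        (A.charpoly.roots.map fun a => (C c * (s.map fun γ => X - C γ).prod).eval a).prod := by
    intro s c
    induction s using Multiset.induction_on with
    | empty =>
      simp only [Multiset.map_zero, Multiset.prod_zero, mul_one, Polynomial.aeval_C, Polynomial.eval_C]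
      exact det_scalar_eq_prod_roots A c
    | cons γ s ih =>
      have hcomm : C c * ((γ ::ₘ s).map fun γ => X - C γ).prod = (X - C γ) * (C c * (s.map fun γ => X - C γ).prod) := by
        rw [Multiset.map_cons, Multiset.prod_cons]; ring
      rw [hcomm, map_mul, Matrix.det_mul, ih]
      have hX : aeval A (X - C γ) = A - Matrix.scalar n γ := by
        rw [map_sub, Polynomial.aeval_X, Polynomial.aeval_C]; rfl
      rw [hX, det_sub_scalar_eq_prod_roots, ← Multiset.prod_map_mul]
      refine congrArg _ (Multiset.map_congr rfl fun a _ => ?_)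
      simp only [Polynomial.eval_mul, Polynomial.eval_sub, Polynomial.eval_X, Polynomial.eval_C]
  have hg := (IsAlgClosed.splits g).eq_prod_roots
  conv_lhs => rw [hg]
  rw [key]
  exact congrArg _ (Multiset.map_congr rfl fun a _ => by rw [← hg])

/-- In particular `det (1 - Aʳ) = ∏ᵢ (1 - aᵢʳ)`. [folklore] -/
theorem det_one_sub_pow_eq_prod_roots (A : Matrix n n K) (r : ℕ) :
    (1 - A ^ r).det = (A.charpoly.roots.map fun a => 1 - a ^ r).prod := by
  have h := det_aeval_eq_prod_roots A (1 - X ^ r)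
  simp only [map_sub, map_one, map_pow, Polynomial.aeval_X, Polynomial.eval_sub, Polynomial.eval_one,
    Polynomial.eval_pow, Polynomial.eval_X] at h
  exact h

/-- And `det A = ∏ aᵢ` (Mathlib's `det_eq_prod_roots_charpoly`), so the eigenvalues of an invertible
matrix are nonzero. [folklore] -/
theorem ne_zero_of_mem_roots_charpoly {A : Matrix n n K} (hA : A.det ≠ 0) {a : K}
    (ha : a ∈ A.charpoly.roots) : a ≠ 0 := by
  rw [Matrix.det_eq_prod_roots_charpoly] at hA
  rintro rfl
  exact hA (Multiset.prod_eq_zero ha)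

end SpectralDet

/-! ### From a linear map over `K₀` to its matrix over an algebraically closed `K̄ ⊇ K₀` -/

section LinearMap

variable {K₀ : Type*} [Field K₀] {V : Type*} [AddCommGroup V] [Module K₀ V] [FiniteDimensional K₀ V]
variable (K : Type*) [Field K] [Algebra K₀ K] [IsAlgClosed K]

/-- The eigenvalues of `f` in `K̄` (roots of the characteristic polynomial, with multiplicity).
[folklore] -/
def eigenvalues (f : V →ₗ[K₀] V) : Multiset K := (f.charpoly.map (algebraMap K₀ K)).roots

/-- The matrix of `f` in the canonical basis, pushed to `K̄`. [folklore] -/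
def matrixOver (f : V →ₗ[K₀] V) :
    Matrix (Module.Free.ChooseBasisIndex K₀ V) (Module.Free.ChooseBasisIndex K₀ V) K :=
  (LinearMap.toMatrix (Module.Free.chooseBasis K₀ V) (Module.Free.chooseBasis K₀ V) f).map (algebraMap K₀ K)

omit [IsAlgClosed K] in
/-- Its characteristic polynomial is that of `f`, pushed to `K̄`. [folklore] -/
theorem charpoly_matrixOver (f : V →ₗ[K₀] V) :
    (matrixOver K f).charpoly = f.charpoly.map (algebraMap K₀ K) := by
  rw [matrixOver, Matrix.charpoly_map, LinearMap.charpoly_def]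

omit [IsAlgClosed K] in
/-- `eigenvalues f = roots of the characteristic polynomial of the matrix over K̄`. [folklore] -/
theorem eigenvalues_eq (f : V →ₗ[K₀] V) : eigenvalues K f = (matrixOver K f).charpoly.roots := by
  rw [eigenvalues, charpoly_matrixOver]

/-- There are `dim V` eigenvalues. [folklore] -/
theorem card_eigenvalues (f : V →ₗ[K₀] V) :
    Multiset.card (eigenvalues K f) = Module.finrank K₀ V := by
  rw [eigenvalues_eq, card_roots_charpoly, Module.finrank_eq_card_chooseBasisIndex]

/-- **`det (1 - fʳ) = ∏ᵢ (1 - aᵢʳ)` in `K̄`** over the eigenvalues `aᵢ` of `f`. [folklore] -/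
theorem algebraMap_det_one_sub_pow (f : V →ₗ[K₀] V) (r : ℕ) :
    algebraMap K₀ K (LinearMap.det (1 - f ^ r)) = ((eigenvalues K f).map fun a => 1 - a ^ r).prod := by
  set b := Module.Free.chooseBasis K₀ V
  have h1 : LinearMap.det (1 - f ^ r) = (1 - (LinearMap.toMatrix b b f) ^ r).det := by
    rw [← LinearMap.det_toMatrix b]
    congr 1
    change LinearMap.toMatrixAlgEquiv b (1 - f ^ r) = 1 - (LinearMap.toMatrixAlgEquiv b f) ^ r
    rw [map_sub, map_one, map_pow]
  rw [h1, RingHom.map_det, eigenvalues_eq, ← det_one_sub_pow_eq_prod_roots]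
  congr 1
  rw [matrixOver, RingHom.mapMatrix_apply, Matrix.map_sub _ (map_sub (algebraMap K₀ K)), Matrix.map_pow,
    Matrix.map_one _ (map_zero _) (map_one _)]

/-- `det f = ∏ᵢ aᵢ` in `K̄`; hence the eigenvalues of an automorphism are nonzero. [folklore] -/
theorem ne_zero_of_mem_eigenvalues {f : V →ₗ[K₀] V} (hf : LinearMap.det f ≠ 0) {a : K}
    (ha : a ∈ eigenvalues K f) : a ≠ 0 := by
  rw [eigenvalues_eq] at ha
  refine ne_zero_of_mem_roots_charpoly ?_ ha
  rw [matrixOver, ← RingHom.mapMatrix_apply, ← RingHom.map_det, LinearMap.det_toMatrix]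
  exact (_root_.map_ne_zero (algebraMap K₀ K)).2 hf

/-- The trace is the sum of the eigenvalues (in `K̄`). [folklore] -/
theorem algebraMap_trace (f : V →ₗ[K₀] V) :
    algebraMap K₀ K (LinearMap.trace K₀ V f) = (eigenvalues K f).sum := by
  set b := Module.Free.chooseBasis K₀ V
  rw [LinearMap.trace_eq_matrix_trace K₀ b, eigenvalues_eq, ← Matrix.trace_eq_sum_roots_charpoly,
    matrixOver, AddMonoidHom.map_trace]

/-- The characteristic polynomial over `K̄` is `∏ (X - aᵢ)`. [folklore] -/
theorem charpoly_map_eq_prod (f : V →ₗ[K₀] V) :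
    f.charpoly.map (algebraMap K₀ K) = ((eigenvalues K f).map fun a => X - C a).prod := by
  rw [← charpoly_matrixOver, eigenvalues_eq]
  exact charpoly_eq_prod_roots _

end LinearMap

/-! ### Power sums determine a multiset of nonzero complex numbers -/

section PowerSums

open Finset FrobeniusMultiset

variable {ι : Type*} [Fintype ι] {κ : Type*} [Fintype κ]

/-- `∑ᵢ aᵢˢ = ∑_{z} #{i : aᵢ = z} · zˢ`, summing over any finite set of values containing the `aᵢ`.
[folklore] -/
theorem sum_pow_eq_sum_cnt_mul_pow (a : ι → ℂ) {W : Finset ℂ} (hW : ∀ i, a i ∈ W) (s : ℕ) :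
    ∑ i, a i ^ s = ∑ z ∈ W, (cnt a z : ℂ) * z ^ s := by
  classical
  rw [Finset.sum_comp (fun z : ℂ => z ^ s) a]
  refine (Finset.sum_subset (fun z hz => ?_) fun z _ hz => ?_).trans (Finset.sum_congr rfl fun z _ => ?_)
  · obtain ⟨i, -, rfl⟩ := Finset.mem_image.1 hz; exact hW i
  · have h0 : ∀ i, a i ≠ z := fun i hi => hz (Finset.mem_image.2 ⟨i, mem_univ i, hi⟩)
    rw [Finset.card_eq_zero.2 (Finset.filter_eq_empty_iff.2 fun i _ hi => h0 i hi), zero_smul]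
  · simp [cnt, nsmul_eq_mul]

/-- **Power sums determine the multiset**: if `aᵢ` (`i ∈ ι`) and `bⱼ` (`j ∈ κ`) are nonzero complex
numbers with `∑ᵢ aᵢˢ = ∑ⱼ bⱼˢ` for all `s ≥ 1`, then they have the same multiset of values (linear
independence of the geometric progressions `s ↦ zˢ`, `FrobeniusMultiset.eq_zero_of_forall_sum_mul_pow_eq_zero`).
This is how the reciprocal roots of the `L`-polynomial of a constant field extension `F𝔽_{q^r}`
are identified with the `r`-th powers `αᵢʳ` from the equality of point counts
`N_s(F𝔽_{q^r}) = N_{rs}(F)` (Stichtenoth Thm. 5.1.15 (f), here without the theory of constant field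
extensions). [folklore] -/
theorem univ_val_map_eq_of_forall_sum_pow_eq {a : ι → ℂ} {b : κ → ℂ} (ha : ∀ i, a i ≠ 0)
    (hb : ∀ j, b j ≠ 0) (h : ∀ s : ℕ, 0 < s → ∑ i, a i ^ s = ∑ j, b j ^ s) :
    (univ : Finset ι).val.map a = (univ : Finset κ).val.map b := by
  classical
  set W : Finset ℂ := univ.image a ∪ univ.image b with hW
  have hWa : ∀ i, a i ∈ W := fun i => Finset.mem_union_left _ (Finset.mem_image_of_mem _ (mem_univ i))
  have hWb : ∀ j, b j ∈ W := fun j => Finset.mem_union_right _ (Finset.mem_image_of_mem _ (mem_univ j))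
  have hcnt : ∀ z, cnt a z = cnt b z := by
    intro z
    by_cases hz : z ∈ W
    · have hz0 : z ≠ 0 := by
        rintro rfl
        rcases Finset.mem_union.1 hz with h' | h'
        · obtain ⟨i, -, hi⟩ := Finset.mem_image.1 h'; exact ha i hi
        · obtain ⟨j, -, hj⟩ := Finset.mem_image.1 h'; exact hb j hj
      have key := eq_zero_of_forall_sum_mul_pow_eq_zero W (fun z => (cnt a z : ℂ) - cnt b z)
        (fun s hs => by
          simp only [sub_mul, Finset.sum_sub_distrib, ← sum_pow_eq_sum_cnt_mul_pow a hWa,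
            ← sum_pow_eq_sum_cnt_mul_pow b hWb, h s hs, sub_self]) hz hz0
      exact_mod_cast sub_eq_zero.1 key
    · have h1 : cnt a z = 0 := Finset.card_eq_zero.2 (Finset.filter_eq_empty_iff.2
        fun i _ hi => hz (hi ▸ hWa i))
      have h2 : cnt b z = 0 := Finset.card_eq_zero.2 (Finset.filter_eq_empty_iff.2
        fun j _ hj => hz (hj ▸ hWb j))
      rw [h1, h2]
  refine Multiset.ext.2 fun z => ?_
  rw [Multiset.count_map, Multiset.count_map]
  have hza := hcnt z
  unfold cnt at hza
  rw [Finset.card_def, Finset.card_def, Finset.filter_val, Finset.filter_val] at hza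
  convert hza using 2 <;> exact Multiset.filter_congr fun x _ => eq_comm

end PowerSums

/-! ### Comparison with complex numbers of constant modulus `> 1` -/

section Complex

open Finset

variable {K₀ : Type*} [Field K₀] {V : Type*} [AddCommGroup V] [Module K₀ V] [FiniteDimensional K₀ V]
variable {K : Type*} [Field K] [Algebra K₀ K] [IsAlgClosed K] (ι : K →+* ℂ)

/-- Enumerating a multiset by `Fin`. [folklore] -/
theorem exists_fin_enum {X : Type*} (s : Multiset X) :
    ∃ (m : ℕ) (e : Fin m → X), (univ : Finset (Fin m)).val.map e = s :=
  ⟨s.toList.length, fun i => s.toList.get i, by rw [Fin.univ_val_map, List.ofFn_get, Multiset.coe_toList]⟩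

variable {f : V →ₗ[K₀] V} {κ : Type*} [Fintype κ] {β : κ → ℂ} {c : ℝ} {N : ℕ → ℤ}

/-- **The eigenvalues of `f` are the `βⱼ`.**  Let `f` be an automorphism of a finite-dimensional
`K₀`-vector space, `K̄ ⊇ K₀` algebraically closed, `ι : K̄ → ℂ` a ring homomorphism, and `βⱼ`
(`j ∈ κ`) complex numbers of constant modulus `c > 1`. If there are integers `N_r` with
`det(1 - fʳ) = N_r` in `K₀` and `N_r = ∏ⱼ (1 - βⱼʳ)` in `ℂ` for all `r ≥ 1`, then `ι` maps the
eigenvalues of `f` (with multiplicity) onto the multiset `{βⱼ}`: since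
`ι(det(1 - fʳ)) = ∏ᵢ (1 - ι(aᵢ)ʳ)` (`algebraMap_det_one_sub_pow`), this is the counting lemma
`FrobeniusMultiset.univ_val_map_eq`. In Weil's setting (`f` = Frobenius on `V_ℓ J`, `N_r = #J(𝔽_{q^r})`,
`βⱼ` = reciprocal roots of the `L`-polynomial) this is "the characteristic roots of Frobenius are the
`αᵢ`" (Milne, *Abelian varieties*, Thm. 19.1; Lang, *Abelian Varieties*, VII §1 Thm. 3).
[folklore] -/
theorem map_eigenvalues_eq (hf : LinearMap.det f ≠ 0) (hc : 1 < c) (hβ : ∀ j, ‖β j‖ = c)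
    (hN : ∀ r : ℕ, 0 < r → (N r : K₀) = LinearMap.det (1 - f ^ r))
    (hNβ : ∀ r : ℕ, 0 < r → (N r : ℂ) = ∏ j, (1 - β j ^ r)) :
    (eigenvalues K f).map ι = (univ : Finset κ).val.map β := by
  obtain ⟨m, e, he⟩ := exists_fin_enum (eigenvalues K f)
  have hmem : ∀ i, e i ∈ eigenvalues K f := fun i => by
    rw [← he]; exact Multiset.mem_map_of_mem _ (Finset.mem_univ_val i)
  have ha0 : ∀ i, ι (e i) ≠ 0 := fun i =>
    (_root_.map_ne_zero ι).2 (ne_zero_of_mem_eigenvalues K hf (hmem i))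
  have h : ∀ r : ℕ, 0 < r → ∏ i, (1 - ι (e i) ^ r) = ∏ j, (1 - β j ^ r) := by
    intro r hr
    rw [← hNβ r hr]
    have h1 := congrArg ι (algebraMap_det_one_sub_pow K f r)
    rw [← hN r hr, map_intCast, map_intCast, ← he, Multiset.map_map, map_multiset_prod,
      Multiset.map_map] at h1
    rw [h1, Finset.prod_eq_multiset_prod]
    refine congrArg _ (Multiset.map_congr rfl fun i _ => ?_)
    simp
  have key := FrobeniusMultiset.univ_val_map_eq ha0 hc hβ h
  rw [← he, Multiset.map_map]
  exact key

include ι in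
/-- … hence `dim V = |κ|`. [folklore] -/
theorem finrank_eq_card (hf : LinearMap.det f ≠ 0) (hc : 1 < c) (hβ : ∀ j, ‖β j‖ = c)
    (hN : ∀ r : ℕ, 0 < r → (N r : K₀) = LinearMap.det (1 - f ^ r))
    (hNβ : ∀ r : ℕ, 0 < r → (N r : ℂ) = ∏ j, (1 - β j ^ r)) :
    Module.finrank K₀ V = Fintype.card κ := by
  have h := congrArg Multiset.card (map_eigenvalues_eq ι hf hc hβ hN hNβ)
  rw [Multiset.card_map, card_eigenvalues] at h
  simpa using h

/-- … the characteristic polynomial of `f`, pushed to `ℂ`, is `∏ⱼ (X - βⱼ)`. [folklore] -/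
theorem charpoly_map_eq (hf : LinearMap.det f ≠ 0) (hc : 1 < c) (hβ : ∀ j, ‖β j‖ = c)
    (hN : ∀ r : ℕ, 0 < r → (N r : K₀) = LinearMap.det (1 - f ^ r))
    (hNβ : ∀ r : ℕ, 0 < r → (N r : ℂ) = ∏ j, (1 - β j ^ r)) :
    f.charpoly.map (ι.comp (algebraMap K₀ K)) = ∏ j, (X - C (β j)) := by
  rw [← Polynomial.map_map, charpoly_map_eq_prod K f, Polynomial.map_multiset_prod, Multiset.map_map,
    Finset.prod_eq_multiset_prod,
    show ((univ : Finset κ).val.map fun j => X - C (β j)) = ((univ : Finset κ).val.map β).map (fun b => X - C b)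
      from (Multiset.map_map (fun b => X - C b) β _).symm,
    ← map_eigenvalues_eq ι hf hc hβ hN hNβ, Multiset.map_map]
  refine congrArg _ (Multiset.map_congr rfl fun a _ => ?_)
  simp [Polynomial.map_sub, Polynomial.map_X, Polynomial.map_C]

/-- … and the trace of `f`, pushed to `ℂ`, is `∑ⱼ βⱼ`. [folklore] -/
theorem map_trace_eq (hf : LinearMap.det f ≠ 0) (hc : 1 < c) (hβ : ∀ j, ‖β j‖ = c)
    (hN : ∀ r : ℕ, 0 < r → (N r : K₀) = LinearMap.det (1 - f ^ r))
    (hNβ : ∀ r : ℕ, 0 < r → (N r : ℂ) = ∏ j, (1 - β j ^ r)) :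
    ι (algebraMap K₀ K (LinearMap.trace K₀ V f)) = ∑ j, β j := by
  rw [algebraMap_trace K f, map_multiset_sum, map_eigenvalues_eq ι hf hc hβ hN hNβ,
    Finset.sum_eq_multiset_sum]

include ι in
/-- **Integrality of the trace**: if moreover `∑ⱼ βⱼ` is a rational integer `t`, then
`Tr f = t` in `K₀` (injectivity of `K₀ → K̄ → ℂ`). [folklore] -/
theorem trace_eq_intCast (hf : LinearMap.det f ≠ 0) (hc : 1 < c) (hβ : ∀ j, ‖β j‖ = c)
    (hN : ∀ r : ℕ, 0 < r → (N r : K₀) = LinearMap.det (1 - f ^ r))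
    (hNβ : ∀ r : ℕ, 0 < r → (N r : ℂ) = ∏ j, (1 - β j ^ r)) {t : ℤ} (ht : (t : ℂ) = ∑ j, β j) :
    LinearMap.trace K₀ V f = t := by
  have h := map_trace_eq ι hf hc hβ hN hNβ
  rw [← ht, show ((t : ℂ)) = ι (algebraMap K₀ K (t : K₀)) by rw [map_intCast, map_intCast]] at h
  exact (algebraMap K₀ K).injective (ι.injective h)

include ι in
/-- **Integrality of the characteristic polynomial**: if `∏ⱼ (X - βⱼ) = P` for a polynomial
`P ∈ ℤ[X]` (e.g. the reciprocal `L`-polynomial), then `charpoly f = P` in `K₀[X]`. [folklore] -/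
theorem charpoly_eq_map_of_prod_eq (hf : LinearMap.det f ≠ 0) (hc : 1 < c) (hβ : ∀ j, ‖β j‖ = c)
    (hN : ∀ r : ℕ, 0 < r → (N r : K₀) = LinearMap.det (1 - f ^ r))
    (hNβ : ∀ r : ℕ, 0 < r → (N r : ℂ) = ∏ j, (1 - β j ^ r)) {P : ℤ[X]}
    (hP : P.map (Int.castRingHom ℂ) = ∏ j, (X - C (β j))) :
    f.charpoly = P.map (Int.castRingHom K₀) := by
  apply Polynomial.map_injective (ι.comp (algebraMap K₀ K)) (ι.comp (algebraMap K₀ K)).injective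
  rw [charpoly_map_eq ι hf hc hβ hN hNβ, ← hP, Polynomial.map_map]
  congr 1
  exact RingHom.ext_int _ _

end Complex

end FrobeniusCharpoly

end Literature.NumberTheory.LFunctions

end
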